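/- Copyright: the b2b-balaban cell (near-miss cell 7), T⁴-continuum fan-out; row NE7b ROUND-2 swarm, seat
t4-ne7b-formalise-leaf-03 (gen 5) (road W-RP, offer «W7» — journal INTENT l.17476; the junction W4c + W-E1 → W6 of
`t4/b2b-balaban-t4-ne7b-p1/LEAVES-NE7b.md` v3.54; file 2 of 2).  Released under the licence of the surrounding project. -/
import Summits.QuantumFields.BalabanUV.T4Continuum.Support.HistoryChessboardGibbsSide
import Summits.QuantumFields.BalabanUV.T4Continuum.Support.HistoryChessboardHeadline

/-!
# Road W-RP: THE W ROAD ON THE DATA'S OWN GIBBS CUBE TOWERS — witness, apex and headline with E1∕E2 discharged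

Summits-side support leaf of the T⁴-continuum cell (rung (B)+1 on a FINITE torus only; NOT infinite volume, NOT the
mass gap, NOT the Clay statement; NOT a proof of the spine estimate NE7b).  Row NE7b, road **W-RP** (R-OWNER-23-2 ∕
R-OWNER-23-8), offer «W7», file 2 of 2: the JUNCTION W4c + W-E1 → W6 BY NAME.  File 1 (`HistoryChessboardGibbsSide`) fixed,
per run and cutoff, the state (`gibbsTower D g₀ K`, the Gibbs tower law of the data's own averagings at `β_K = (g₀ K)⁻²`),
the partition function (`Zrun`), the observable (`obsTower K os`) and the cube-cut reflections ∕ positive algebras, and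
reduced W4b′'s 21-clause `CutoffReading` + E1∕E2 to the ELEVEN-clause event model `GibbsCubeSide` (`prob`, the RP five,
`Z_pos`, `obs_meas` ∕ `obs_bdd` ∕ `ob_nonneg`, E1∕E2 theorems BY NAME: W3m ∕ W4c ∕ W-E1).  This file assembles the two runs
of a string into W6's `HistoryChessboardApex.ChessboardRoadWitness` (this lineage, p225502) and draws the four T⁴ targets
and `ContinuumYM4Torus D` through W6's headline file (p225792).  [folklore] bookkeeping over TREE theorems; ONE hypothesis
shape (`ChessboardGibbsWitness`, `Type`-valued like `ChessboardRoadWitness`, consumed only under `Nonempty` inside a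
binder) and one `def` (`toRoadWitness`, the field-by-field junction); nothing printed is asserted, no `[cite:]` tag, no
`Prop`-valued FACT minted (c1), no constant (c2∕c6), no exit ∕ socket ∕ `HistoryConstants` file touched (c3).

WHAT.  §3 **`structure ChessboardGibbsWitness D g₀ os ι Λ m₁`** = W6's `ChessboardRoadWitness` with carriers ∕ states ∕
`Z` ∕ `obs` ∕ `ob` ∕ `θ` ∕ `mP` FIXED — run A at cutoff `K`: the `K`-tower `Tower (F.P K) G K` under `gibbsTower D g₀ K`; run
B: the `(K+1)`-tower under `gibbsTower D g₀ (K+1)`, terms indexed by `T K` (the shape of W-E1's `reprB_of_repr`) — and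
the fields `even` ∕ `readingA` ∕ `readingB` ∕ `reprA` ∕ `reprB` REPLACED by `sideA` ∕ `sideB` (families of file 1's
`GibbsCubeSide`); every other field as in W6 (source radius, volume factor, threshold, patterns, term families and
weights, shell parts, bad classes, summable per-cell rates, NE7c's `ShellWeightBound`, NE7's `ReindexedBudget`, four
summable rates).  **`ChessboardGibbsWitness.toRoadWitness (hBA : D.IsBlockAveraged ℰ) (hE : ℰ.MeasurableE)`**: for
(0.4)-block-averaged `SU(n)` data with a measurable small-loop average, the W6 road witness on the carriers
`K ↦ Tower (F.P K) SU(n) K` ∕ `K ↦ Tower (F.P (K+1)) SU(n) (K+1)` with `even := even_cubeCount`, `readingA ∕ readingB :=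
GibbsCubeSide.cutoffReading`, `reprA ∕ reprB := reprA_of_sides ∕ reprB_of_sides` — E1∕E2 DISCHARGED.  §4 the ENDs over W6
BY NAME: `stringHybridNE7_of_gibbsWitness`, `forSmallCouplings_roadWitness_of_gibbsWitness` (the prefixed hypothesis
transport), `forSmallCouplings_stringwise_of_gibbsWitness` (PIN-FREE), `hybridNE7Under_of_gibbsWitness_fsc`,
`targets_of_gibbsWitness_fsc`, **`continuumYM4Torus_of_gibbsWitness_fsc (hBA) (hE) (hB) (hβ) (hData)`** — the two pins
`(B) = B16.EndStatementBPrinted D.C` and `BetaPertHyp D.βfun` enter BY NAME inside W6's `continuumYM4Torus_of_chessboardRoad_fsc`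
only (at `T4ContinuumYM4Torus.continuumYM4Torus_of_targets`).

HONEST READING (verbatim for headlines; c4, R-OWNER-23-8 wording).  «Row NE7b, road W-RP (the printed, centred 4-d averaging
prescription [B12] (0.3)–(0.4)) ON THE DATA'S OWN GIBBS CUBE TOWERS: kernel-complete BY NAME from the displayed readings to
`ContinuumYM4Torus D`: `ContinuumYM4Torus D ⇐ (B) ∧ BetaPertHyp ∧ [∀ small-coupling tuned run ∀ string: a
ChessboardGibbsWitness]`, and the witness DISPLAYS — as hypothesis shapes, none in print, none a theorem of the tree — per
run and cutoff the ELEVEN clauses of `GibbsCubeSide` ((EXT) proper `repr`: that the terms of Bałaban's 𝐑-operation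
expansion ARE event weights of the Gibbs tower; `bad_subset` ∕ `ev_meas` ∕ `E_meas`; the partition `ev_cover` + `ev_disj`;
(EXT)∘(LOC) `bad_sub`; (LOC) `loc` and (R-sym) `sym` of the chosen cube-cell events; (U1)+(G2) `univ_le` with (B)'s lower
half INSIDE as a reading; `r_nonneg`), NE7c's `ShellWeightBound`, NE7's `ReindexedBudget` (carrying node U4′'s sizes and the
recent-scale rates, hence the content of NE1′–NE5, NE9) and six summable rates; `prob`, the RP five ((RP-ext) = the
covariance reading (γ) of the printed average, rows W3f–W3m ∕ W4c), `Even`, `Z_pos`, `obs_*` and the E1∕E2 representation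
identities (W-E1) are THEOREMS BY NAME; the identifications «`blockAvg ℰ` is (0.4)» and «the run's state at cutoff `K` is
the Gibbs tower law» are READINGS (T-class); the W-road END consumes neither pin nor the coupling window.  NOTHING of the
nine discharged; spine count 0∕9 UNCHANGED; NE7b NOT proved; finite T⁴ only.»  HONEST DEPENDENCY (cell): continuum YM on T⁴
⇐ BetaPertH ∧ nine spine estimates (0/9 proved); BetaPertH ⇐ (D1) ∧ (D4) ∧ CAP+tail; G-an2-4 gates asym, D1 and NE2/3/4.
This file changes none of it. -/

open Finset MeasureTheory
open Literature.Barriers.CriticalPhenomena.NonGibbs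
open Literature.MathematicalPhysics.QuantumFieldTheory.Balaban1983to89
open Literature.MathematicalPhysics.QuantumFieldTheory.Balaban1983to89.Missing
open Literature.MathematicalPhysics.QuantumFieldTheory.Balaban1983to89.T4Continuum
open Literature.MathematicalPhysics.QuantumFieldTheory.Balaban1983to89.T4IndicatorShell
open Literature.MathematicalPhysics.QuantumFieldTheory.Balaban1983to89.T4MatchingAssembly
open Literature.MathematicalPhysics.QuantumFieldTheory.Balaban1983to89.T4MatchingClosure
open Summit.QuantumFields.BalabanUV.T4Continuum
open HistoryRPTowerLaw HistoryChessboardEventsCubes HistoryChessboardTowerRepr HistoryChessboardApex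
open HistoryChessboardHeadline HistoryChessboardGibbsSide

namespace Summit.QuantumFields.BalabanUV.T4Continuum.HistoryChessboardGibbs

noncomputable section

/-! ## §3 The chessboard witness on the data's own Gibbs cube towers ⇒ W6's road witness -/

section Witness

variable {F : T4Family} {G : Type} [GaugeGroup G] [MeasurableSpace G] [HaarData G]

/-- **A CHESSBOARD WITNESS ON THE DATA'S OWN GIBBS CUBE TOWERS for the tuned run `g₀` and the loop string `os`**
(HYPOTHESIS SHAPE — data + displayed binders, NOTHING asserted): W6's `ChessboardRoadWitness` with the carriers, states,
partition functions, observables, reflections and positive algebras FIXED — run A at cutoff `K` on `Tower (F.P K) G K`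
under `gibbsTower D g₀ K`, run B on `Tower (F.P (K+1)) G (K+1)` under `gibbsTower D g₀ (K+1)`, both read through
`GibbsCubeSide` (cubes of side `L^{m₁}`, `hm₁ : m₁ ≤ m`) — and otherwise W6's fields: source radius, volume factor,
threshold, patterns, term families and weights, shell parts, bad classes, summable per-cell rates, NE7c's
`ShellWeightBound`, NE7's `ReindexedBudget` with four summable rates.  NO `even` ∕ `readingA` ∕ `readingB` ∕ `reprA` ∕
`reprB` field: they are PRODUCED (`toRoadWitness`). [folklore] -/
structure ChessboardGibbsWitness (D : FiniteEpsData F G) (g₀ : ℕ → ℝ) (os : List (ULoop F)) (ι Λ : Type)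
    [DecidableEq ι] (m₁ : ℕ) : Type where
  /-- the cubes have side `L^{m₁}`, `m₁ ≤ m` -/
  hm₁ : m₁ ≤ F.m
  /-- the source radius -/
  l₀ : ℝ
  /-- the volume factor of the matching remainders -/
  vol : ℝ
  /-- the source radius is positive -/
  l₀_pos : 0 < l₀
  /-- the volume factor is positive -/
  vol_pos : 0 < vol
  /-- the threshold in the number of steps -/
  K₀ : ℕ
  /-- the finite family of patterns (the shifted tilings) -/
  P : Finset Λ
  /-- the term families -/
  T : ℕ → Finset ι
  /-- run A's term weights (`K` steps) -/
  A : ℕ → ℝ → ι → ℝ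
  /-- run B's term weights (`K + 1` steps) -/
  A' : ℕ → ℝ → ι → ℝ
  /-- the two runs' shell parts (NE7c) -/
  (shA shB : ℕ → ℝ → ι → ℝ)
  /-- the bad classes -/
  Bad : ℕ → Finset ι
  /-- run A: term events on the `K`-tower -/
  ev : ∀ K, ι → Set (Tower (F.P K) G K)
  /-- run A: cell events of the patterns on the `K`-tower -/
  E : ∀ K, Λ → BlockIdx 4 (cubeCount F m₁) → Set (Tower (F.P K) G K)
  /-- run A: per-cell rates -/
  r : ℕ → ℝ
  /-- run B: term events on the `(K+1)`-tower -/
  ev' : ∀ K, ι → Set (Tower (F.P (K + 1)) G (K + 1))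
  /-- run B: cell events of the patterns on the `(K+1)`-tower -/
  E' : ∀ K, Λ → BlockIdx 4 (cubeCount F m₁) → Set (Tower (F.P (K + 1)) G (K + 1))
  /-- run B: per-cell rates -/
  r' : ℕ → ℝ
  /-- run A's per-cutoff event model from the threshold on -/
  sideA : ∀ K, K₀ ≤ K → GibbsCubeSide D g₀ os hm₁ K P (T K) (A K) (Bad K) (ev K) (E K) (r K)
  /-- run B's per-cutoff event model from the threshold on (the `(K+1)`-step run, terms indexed by `T K`) -/
  sideB : ∀ K, K₀ ≤ K → GibbsCubeSide D g₀ os hm₁ (K + 1) P (T K) (A' K) (Bad K) (ev' K) (E' K) (r' K)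
  /-- run A's per-cell rates are summable over the cutoff -/
  sum_r : Summable r
  /-- run B's per-cell rates are summable over the cutoff -/
  sum_r' : Summable r'
  /-- NE7 core budget data (`ReindexedBudget`) -/
  (Cc Rr CcRec RrRec : ℕ → ℝ → ι → ℝ)
  /-- NE7 core budget rates; `rr u s s₂` summable -/
  (ν u s₂ c₀ rr s : ℕ → ℝ)
  /-- NE7c's shell weight budget -/
  Wsh : ℕ → ℝ
  /-- NE7c: the indicator shells' relative weight bound -/
  shell : ShellWeightBound l₀ T A A' shA shB Wsh
  /-- NE7: the core budget on the hybrid cores over the bad classes -/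
  budget : ReindexedBudget l₀ vol T (fun K t τ => A K t τ - shA K t τ) (fun K t τ => A' K t τ - shB K t τ)
    (fun K _ => Bad K) Cc Rr CcRec RrRec ν u s₂ c₀ rr s
  /-- summable rates -/
  sum_rr : Summable rr
  /-- summable rates -/
  sum_u : Summable u
  /-- summable rates -/
  sum_s : Summable s
  /-- summable rates -/
  sum_s₂ : Summable s₂

variable {n : ℕ} [NeZero n] {D : FiniteEpsData F (Matrix.specialUnitaryGroup (Fin n) ℂ)}
  {ℰ : LoopAverage (Matrix.specialUnitaryGroup (Fin n) ℂ)} {g₀ : ℕ → ℝ} {os : List (ULoop F)} {ι Λ : Type}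
  [DecidableEq ι] {m₁ : ℕ}

/-- **THE JUNCTION W4c + W-E1 → W6**: a chessboard witness on the data's own Gibbs cube towers IS a W6 road witness on the
carriers `K ↦ Tower (F.P K) SU(n) K` ∕ `K ↦ Tower (F.P (K+1)) SU(n) (K+1)` with `4c`'s cube count, for
(0.4)-block-averaged `SU(n)` data with a measurable small-loop average — `even := even_cubeCount`, `readingA ∕ readingB :=
GibbsCubeSide.cutoffReading`, **`reprA ∕ reprB := reprA_of_sides ∕ reprB_of_sides` (E1∕E2 DISCHARGED)**, every other field
copied. [folklore] -/
def ChessboardGibbsWitness.toRoadWitness (hBA : D.IsBlockAveraged ℰ) (hE : ℰ.MeasurableE)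
    (X : ChessboardGibbsWitness D g₀ os ι Λ m₁) :
    ChessboardRoadWitness D g₀ os ι Λ (fun K => Tower (F.P K) (Matrix.specialUnitaryGroup (Fin n) ℂ) K)
      (fun K => Tower (F.P (K + 1)) (Matrix.specialUnitaryGroup (Fin n) ℂ) (K + 1)) 4 (cubeCount F m₁) where
  l₀ := X.l₀
  vol := X.vol
  l₀_pos := X.l₀_pos
  vol_pos := X.vol_pos
  K₀ := X.K₀
  even := even_cubeCount (F.P 0) m₁
  P := X.P
  T := X.T
  A := X.A
  A' := X.A'
  shA := X.shA
  shB := X.shB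
  Bad := X.Bad
  μ := fun K => gibbsTower D g₀ K
  Z := fun K => Zrun D K (g₀ K)
  ev := X.ev
  obs := fun K => obsTower K os
  ob := 1
  E := X.E
  θ := fun K => cubeRefl (sitesPerDir_top_eq F X.hm₁ K)
  mP := fun K => cubePos (Matrix.specialUnitaryGroup (Fin n) ℂ) (sitesPerDir_top_eq F X.hm₁ K)
  r := X.r
  μ' := fun K => gibbsTower D g₀ (K + 1)
  Z' := fun K => Zrun D (K + 1) (g₀ (K + 1))
  ev' := X.ev'
  obs' := fun K => obsTower (K + 1) os
  E' := X.E'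
  θ' := fun K => cubeRefl (sitesPerDir_top_eq F X.hm₁ (K + 1))
  mP' := fun K => cubePos (Matrix.specialUnitaryGroup (Fin n) ℂ) (sitesPerDir_top_eq F X.hm₁ (K + 1))
  r' := X.r'
  readingA := fun K hK => (X.sideA K hK).cutoffReading hBA hE
  readingB := fun K hK => (X.sideB K hK).cutoffReading hBA hE
  sum_r := X.sum_r
  sum_r' := X.sum_r'
  Cc := X.Cc
  Rr := X.Rr
  CcRec := X.CcRec
  RrRec := X.RrRec
  ν := X.ν
  u := X.u
  s₂ := X.s₂
  c₀ := X.c₀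
  rr := X.rr
  s := X.s
  Wsh := X.Wsh
  shell := X.shell
  budget := X.budget
  sum_rr := X.sum_rr
  sum_u := X.sum_u
  sum_s := X.sum_s
  sum_s₂ := X.sum_s₂
  reprA := reprA_of_sides (hBA.avgMeasurable hE) X.sideA
  reprB := reprB_of_sides (hBA.avgMeasurable hE) X.sideB

/-! ## §4 The ENDs over W6, by name -/

/-- **ONE STRING**: a chessboard witness on the data's Gibbs cube towers ⇒ the apex lineage's per-string datum
`StringHybridNE7 (D.scheme g₀) os l₀ vol K`, some `K ≥ K₀` — W6's `stringHybridNE7_of_chessboardRoad` on `toRoadWitness`.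
CONDITIONAL on the displayed witness; NE7b NOT proved. [folklore] -/
theorem stringHybridNE7_of_gibbsWitness (hBA : D.IsBlockAveraged ℰ) (hE : ℰ.MeasurableE)
    (X : ChessboardGibbsWitness D g₀ os ι Λ m₁) : ∃ K, X.K₀ ≤ K ∧ StringHybridNE7 (D.scheme g₀) os X.l₀ X.vol K :=
  stringHybridNE7_of_chessboardRoad (X.toRoadWitness hBA hE)

/-- The junction keeps the threshold, the source radius and the volume factor (definitionally). [folklore] -/
example (hBA : D.IsBlockAveraged ℰ) (hE : ℰ.MeasurableE) (X : ChessboardGibbsWitness D g₀ os ι Λ m₁) :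
    (X.toRoadWitness hBA hE).K₀ = X.K₀ ∧ (X.toRoadWitness hBA hE).l₀ = X.l₀ ∧ (X.toRoadWitness hBA hE).vol = X.vol :=
  ⟨rfl, rfl, rfl⟩

end Witness

section Under

variable {F : T4Family} {n : ℕ} [NeZero n] {ℰ : LoopAverage (Matrix.specialUnitaryGroup (Fin n) ℂ)}

/-- The prefixed Gibbs-witness hypothesis gives W6's prefixed road-witness hypothesis (`ForSmallCouplings.mono` with
`toRoadWitness`). [folklore] -/
theorem forSmallCouplings_roadWitness_of_gibbsWitness (D : FiniteEpsData F (Matrix.specialUnitaryGroup (Fin n) ℂ))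
    (hBA : D.IsBlockAveraged ℰ) (hE : ℰ.MeasurableE)
    (hData : T4ContinuumYM4Torus.ForSmallCouplings D fun g₀ => ∀ os : List (ULoop F),
      ∃ (ι Λ : Type) (_ : DecidableEq ι) (m₁ : ℕ), Nonempty (ChessboardGibbsWitness D g₀ os ι Λ m₁)) :
    T4ContinuumYM4Torus.ForSmallCouplings D fun g₀ => ∀ os : List (ULoop F),
      ∃ (ι Λ : Type) (_ : DecidableEq ι) (Ω Ω' : ℕ → Type) (_ : ∀ K, MeasurableSpace (Ω K))
        (_ : ∀ K, MeasurableSpace (Ω' K)) (d M : ℕ) (_ : NeZero M),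
        Nonempty (ChessboardRoadWitness D g₀ os ι Λ Ω Ω' d M) :=
  hData.mono fun g₀ h os => by
    obtain ⟨ι, Λ, _, m₁, ⟨X⟩⟩ := h os
    exact ⟨ι, Λ, ‹_›, _, _, inferInstance, inferInstance, 4, cubeCount F m₁, inferInstance, ⟨X.toRoadWitness hBA hE⟩⟩

/-- **ROW NE7b, ROAD W-RP ON THE GIBBS CUBE TOWERS, AT THE APEX — PIN-FREE**: if for all SMALL-coupling tuned runs and every
loop string a `ChessboardGibbsWitness` is displayed, then for the same runs every string carries the apex lineage's
hybrid-NE7 datum; NEITHER `(B)` NOR `BetaPertHyp` is an input (W6's `forSmallCouplings_stringwise_of_chessboardRoad`).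
CONDITIONAL; NE7b NOT proved. [folklore] -/
theorem forSmallCouplings_stringwise_of_gibbsWitness (D : FiniteEpsData F (Matrix.specialUnitaryGroup (Fin n) ℂ))
    (hBA : D.IsBlockAveraged ℰ) (hE : ℰ.MeasurableE)
    (hData : T4ContinuumYM4Torus.ForSmallCouplings D fun g₀ => ∀ os : List (ULoop F),
      ∃ (ι Λ : Type) (_ : DecidableEq ι) (m₁ : ℕ), Nonempty (ChessboardGibbsWitness D g₀ os ι Λ m₁)) :
    T4ContinuumYM4Torus.ForSmallCouplings D fun g₀ => T4ApexHybrid.StringwiseHybridNE7 (D.scheme g₀) :=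
  forSmallCouplings_stringwise_of_chessboardRoad D (forSmallCouplings_roadWitness_of_gibbsWitness D hBA hE hData)

/-- **`HybridNE7Under D (BetaPertHyp D.βfun)` FROM THE PREFIXED GIBBS WITNESSES** — the apex lineage's input for all four
T⁴ targets; the two antecedents are accepted and not used (W6's `hybridNE7Under_of_chessboardRoad_fsc`).  CONDITIONAL;
NE7b NOT proved. [folklore] -/
theorem hybridNE7Under_of_gibbsWitness_fsc (D : FiniteEpsData F (Matrix.specialUnitaryGroup (Fin n) ℂ))
    (hBA : D.IsBlockAveraged ℰ) (hE : ℰ.MeasurableE)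
    (hData : T4ContinuumYM4Torus.ForSmallCouplings D fun g₀ => ∀ os : List (ULoop F),
      ∃ (ι Λ : Type) (_ : DecidableEq ι) (m₁ : ℕ), Nonempty (ChessboardGibbsWitness D g₀ os ι Λ m₁)) :
    T4ApexHybrid.HybridNE7Under D (BetaPertHyp D.βfun) :=
  hybridNE7Under_of_chessboardRoad_fsc D (forSmallCouplings_roadWitness_of_gibbsWitness D hBA hE hData)

/-- **THE FOUR T⁴ TARGETS FROM THE W ROAD ON THE GIBBS CUBE TOWERS** (W6's `targets_of_chessboardRoad_fsc`): NO PIN IS AN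
INPUT (each target carries its own prefix).  CONDITIONAL on the displayed prefixed witnesses; NE7b NOT proved. [folklore] -/
theorem targets_of_gibbsWitness_fsc (D : FiniteEpsData F (Matrix.specialUnitaryGroup (Fin n) ℂ))
    (hBA : D.IsBlockAveraged ℰ) (hE : ℰ.MeasurableE)
    (hData : T4ContinuumYM4Torus.ForSmallCouplings D fun g₀ => ∀ os : List (ULoop F),
      ∃ (ι Λ : Type) (_ : DecidableEq ι) (m₁ : ℕ), Nonempty (ChessboardGibbsWitness D g₀ os ι Λ m₁)) :
    D.ym4_torus_continuum_limit_exists ∧ D.ym4_torus_continuum_limit_unique ∧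
      D.limit_reflectionPositive ∧ D.limit_torusCovariant :=
  targets_of_chessboardRoad_fsc D hBA hE (forSmallCouplings_roadWitness_of_gibbsWitness D hBA hE hData)

/-- **THE HEADLINE PREDICATE FROM THE W ROAD ON THE DATA'S OWN GIBBS CUBE TOWERS**: `ContinuumYM4Torus D` for
(0.4)-block-averaged `SU(n)` data with a measurable small-loop average, GIVEN the two pins `(B)` and `BetaPertHyp D.βfun` BY
NAME (consumed only inside W6's `continuumYM4Torus_of_chessboardRoad_fsc`, at `continuumYM4Torus_of_targets`) and, for all
small-coupling tuned runs and every loop string, a `ChessboardGibbsWitness`.  Honest reading: «road W-RP (the printed,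
centred 4-d prescription [B12] (0.3)–(0.4)) on the data's own Gibbs cube towers: kernel-complete BY NAME from the
displayed ELEVEN-clause event models (`GibbsCubeSide`, per run and cutoff) + NE7c + NE7 + rates to `ContinuumYM4Torus D`;
`prob`, the RP five, `Even`, `Z_pos`, `obs_*`, E1∕E2 theorems by name; nothing of the nine discharged; NE7b NOT proved;
0∕9; finite T⁴ only». [folklore] -/
theorem continuumYM4Torus_of_gibbsWitness_fsc (D : FiniteEpsData F (Matrix.specialUnitaryGroup (Fin n) ℂ))
    (hBA : D.IsBlockAveraged ℰ) (hE : ℰ.MeasurableE) (hB : B16.EndStatementBPrinted D.C) (hβ : BetaPertHyp D.βfun)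
    (hData : T4ContinuumYM4Torus.ForSmallCouplings D fun g₀ => ∀ os : List (ULoop F),
      ∃ (ι Λ : Type) (_ : DecidableEq ι) (m₁ : ℕ), Nonempty (ChessboardGibbsWitness D g₀ os ι Λ m₁)) :
    T4ContinuumYM4Torus.ContinuumYM4Torus D :=
  continuumYM4Torus_of_chessboardRoad_fsc D hBA hE hB hβ (forSmallCouplings_roadWitness_of_gibbsWitness D hBA hE hData)

end Under

end

end Summit.QuantumFields.BalabanUV.T4Continuum.HistoryChessboardGibbs
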